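import Mathlib.Analysis.SpecialFunctions.Stirling
import Mathlib.Analysis.Complex.ExponentialBounds
import Literature.Barriers.ValiantsHypothesis.ShiftedPartialsCaseC2
import HarnessLib

/-!
# HANDOFF — ASYMPTOTICS (C): the size of the profile value `Φ(9y²/64)` (rh-explicit, track «HANDOFF», seat prove-2 gen10, ATTEMPT-19 §8 (P6))

HONEST FRAMING. Nothing here bears on the truth of RH; elementary real analysis (Mathlib + the Stirling upper bound
`j! ≤ e√j (j/e)^j` of `Literature.Barriers.ValiantsHypothesis.factorial_le_stirling`). For the profile series
`Φ(x) = Σ_m x^m/(m!(2m)!)` (given here as a `HasSum` hypothesis, so that this file is independent of the track's definition files)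
we prove the single-term lower bound `x^m/(m!(2m)!) ≥ (e³x/(4m³))^m/(e²√2·m)` and, at the programme's choice `y = (3/5)·L^{3/2}`,
`x = 9y²/64 = 81L³/1600`, `m = ⌊10L/43⌋`: **`Φ(x) ≥ e^{30L/43 − 3}/(3L)`** for `L ≥ 43`. No `sorry`, standard axioms.

References: this track (ATTEMPT-16 §5, ATTEMPT-19 §8 (P6)); Stirling (Mathlib `Stirling.stirlingSeq'_antitone`).
-/

set_option linter.dupNamespace false

noncomputable section

open Real

namespace Summit.RiemannHypothesis.RiemannHypothesis.Theorems.Handoff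

/-- **Single-term Stirling minorant.** For `x ≥ 0` and `m ≥ 1`: `(e³x/(4m³))^m/(e²√2·m) ≤ x^m/(m!(2m)!)`
(from `m! ≤ e√m(m/e)^m`, `(2m)! ≤ e√(2m)(2m/e)^{2m}`). [this track, ATTEMPT-19 §8 (P6)] -/
theorem profileTerm_ge_stirling {x : ℝ} (hx : 0 ≤ x) {m : ℕ} (hm : 1 ≤ m) :
    (Real.exp 3 * x / (4 * (m : ℝ) ^ 3)) ^ m / (Real.exp 2 * Real.sqrt 2 * m) ≤
      x ^ m / ((m.factorial : ℝ) * ((2 * m).factorial : ℝ)) := by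
  have hm0 : (0 : ℝ) < m := by exact_mod_cast hm
  set E := Real.exp 1 with hE
  have hE0 : 0 < E := Real.exp_pos 1
  have h1 := Literature.Barriers.ValiantsHypothesis.factorial_le_stirling hm
  have h2 := Literature.Barriers.ValiantsHypothesis.factorial_le_stirling (j := 2 * m) (by omega)
  rw [← hE] at h1 h2
  have hD : (m.factorial : ℝ) * ((2 * m).factorial : ℝ) ≤
      (E * √(m : ℝ) * ((m : ℝ) / E) ^ m) * (E * √((2 * m : ℕ) : ℝ) * (((2 * m : ℕ) : ℝ) / E) ^ (2 * m)) :=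
    mul_le_mul h1 h2 (by positivity) (by positivity)
  have hsq : √((2 * m : ℕ) : ℝ) = √2 * √(m : ℝ) := by
    rw [Nat.cast_mul, Nat.cast_two, Real.sqrt_mul (by norm_num)]
  have hmm : √(m : ℝ) * √(m : ℝ) = m := Real.mul_self_sqrt hm0.le
  have key : (E * √(m : ℝ) * ((m : ℝ) / E) ^ m) * (E * √((2 * m : ℕ) : ℝ) * (((2 * m : ℕ) : ℝ) / E) ^ (2 * m)) =
      E ^ 2 * √2 * m * (4 : ℝ) ^ m * (m : ℝ) ^ (3 * m) / E ^ (3 * m) := by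
    rw [hsq, Nat.cast_mul, Nat.cast_two]
    have h4 : ((2 : ℝ) * m) ^ (2 * m) = (4 : ℝ) ^ m * (m : ℝ) ^ (2 * m) := by
      rw [mul_pow, pow_mul]; norm_num
    calc E * √(m : ℝ) * ((m : ℝ) / E) ^ m * (E * (√2 * √(m : ℝ)) * (2 * (m : ℝ) / E) ^ (2 * m))
        = E ^ 2 * √2 * (√(m : ℝ) * √(m : ℝ)) * (((m : ℝ) / E) ^ m * ((2 * (m : ℝ)) / E) ^ (2 * m)) := by ring
      _ = E ^ 2 * √2 * m * (4 : ℝ) ^ m * (m : ℝ) ^ (3 * m) / E ^ (3 * m) := by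
        rw [hmm, div_pow, div_pow, h4]
        field_simp
        ring
  have h3 : Real.exp 3 = E ^ 3 := by
    have h := Real.exp_one_pow 3
    push_cast at h
    rw [hE]; exact h.symm
  have h2' : Real.exp 2 = E ^ 2 := by
    have h := Real.exp_one_pow 2
    push_cast at h
    rw [hE]; exact h.symm
  calc (Real.exp 3 * x / (4 * (m : ℝ) ^ 3)) ^ m / (Real.exp 2 * Real.sqrt 2 * m)
      = x ^ m / (E ^ 2 * √2 * m * (4 : ℝ) ^ m * (m : ℝ) ^ (3 * m) / E ^ (3 * m)) := by
        rw [h3, h2', div_pow, mul_pow, mul_pow, ← pow_mul, ← pow_mul]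
        field_simp
    _ ≤ x ^ m / ((m.factorial : ℝ) * ((2 * m).factorial : ℝ)) := by
        rw [← key]
        exact div_le_div_of_nonneg_left (by positivity) (by positivity) hD

/-- **The profile value at the programme's parameters.** With `y = (3/5)L^{3/2}`, `x = 9y²/64 = 81L³/1600` and the single term
`m = ⌊10L/43⌋` (so that `e³x/(4m³) ≥ e³`): `Φ(x) ≥ e^{30L/43 − 3}/(3L)` for `L ≥ 43`, `Φ` being the sum of the series
`Σ x^m/(m!(2m)!)`. [this track, ATTEMPT-19 §8 (P6)] -/
theorem profile_value_lower {L Φ : ℝ} (hL : 43 ≤ L)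
    (hΦ : HasSum (fun m : ℕ => (9 * (3 / 5 * (L * Real.sqrt L)) ^ 2 / 64) ^ m /
      ((m.factorial : ℝ) * ((2 * m).factorial : ℝ))) Φ) :
    Real.exp (30 * L / 43 - 3) / (3 * L) ≤ Φ := by
  have hL0 : 0 < L := by linarith
  set x : ℝ := 9 * (3 / 5 * (L * Real.sqrt L)) ^ 2 / 64 with hxdef
  have hx : x = 81 * L ^ 3 / 1600 := by
    rw [hxdef, mul_pow, mul_pow, Real.sq_sqrt hL0.le]; ring
  have hx0 : 0 ≤ x := by rw [hx]; positivity
  set m : ℕ := ⌊10 * L / 43⌋₊ with hmdef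
  have hmle : (m : ℝ) ≤ 10 * L / 43 := Nat.floor_le (by positivity)
  have hmge : 10 * L / 43 - 1 ≤ (m : ℝ) := by
    have := Nat.lt_floor_add_one (10 * L / 43); rw [← hmdef] at this; linarith
  have hm1 : 1 ≤ m := by
    have : (1 : ℝ) ≤ (m : ℝ) := by
      have h10 : (10 : ℝ) ≤ 10 * L / 43 := by rw [le_div_iff₀ (by norm_num)]; linarith
      have : (1 : ℕ) ≤ m := by
        rw [hmdef]; exact Nat.le_floor (by push_cast; linarith)
      exact_mod_cast this
    exact_mod_cast this
  have hm0 : (0 : ℝ) < m := by exact_mod_cast hm1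
  -- the single term
  have hterm := le_hasSum hΦ m fun j _ => by positivity
  refine le_trans ?_ (le_trans (profileTerm_ge_stirling hx0 hm1) hterm)
  -- `e³ ≤ e³x/(4m³)`
  have hE3 : 0 < Real.exp 3 := Real.exp_pos 3
  have hratio : Real.exp 3 ≤ Real.exp 3 * x / (4 * (m : ℝ) ^ 3) := by
    rw [le_div_iff₀ (by positivity), hx]
    have hm3 : (m : ℝ) ^ 3 ≤ (10 * L / 43) ^ 3 := pow_le_pow_left₀ hm0.le hmle 3
    have : 4 * (10 * L / 43) ^ 3 ≤ 81 * L ^ 3 / 1600 := by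
      rw [div_pow, le_div_iff₀ (by norm_num)]; nlinarith [pow_pos hL0 3]
    nlinarith [hE3]
  have hpow : Real.exp (3 * m) ≤ (Real.exp 3 * x / (4 * (m : ℝ) ^ 3)) ^ m := by
    rw [show (3 : ℝ) * m = (m : ℕ) * 3 by ring, Real.exp_nat_mul]
    exact pow_le_pow_left₀ hE3.le hratio m
  -- denominators: `e²√2·m ≤ 3L`
  have he2 : Real.exp 2 < 7.3891 := by
    have h := Real.exp_one_lt_d9
    have h2 : Real.exp 2 = Real.exp 1 ^ 2 := by exact_mod_cast (Real.exp_one_pow 2).symm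
    rw [h2]; nlinarith [Real.exp_pos 1]
  have hs2 : Real.sqrt 2 < 1.4143 := by
    rw [Real.sqrt_lt' (by norm_num)]; norm_num
  have hden : Real.exp 2 * Real.sqrt 2 * m ≤ 3 * L := by
    have h1 : Real.exp 2 * Real.sqrt 2 ≤ 7.3891 * 1.4143 :=
      mul_le_mul he2.le hs2.le (Real.sqrt_nonneg _) (by norm_num)
    have h2 : Real.exp 2 * Real.sqrt 2 * m ≤ 7.3891 * 1.4143 * (10 * L / 43) :=
      mul_le_mul h1 hmle hm0.le (by norm_num)
    have h3 : 7.3891 * 1.4143 * (10 * L / 43) ≤ 3 * L := by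
      rw [mul_div_assoc']; rw [div_le_iff₀ (by norm_num)]; nlinarith
    linarith
  have hden0 : 0 < Real.exp 2 * Real.sqrt 2 * m := by positivity
  -- numerators: `e^{30L/43 − 3} ≤ e^{3m}`
  have hnum : Real.exp (30 * L / 43 - 3) ≤ Real.exp (3 * m) := Real.exp_le_exp.2 (by linarith)
  calc Real.exp (30 * L / 43 - 3) / (3 * L) ≤ Real.exp (3 * m) / (Real.exp 2 * Real.sqrt 2 * m) :=
        div_le_div₀ (Real.exp_pos _).le hnum hden0 hden
    _ ≤ _ := div_le_div_of_nonneg_right hpow hden0.le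

end Summit.RiemannHypothesis.RiemannHypothesis.Theorems.Handoff
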